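import Mathlib
import Literature.AlgebraicGeometry.Tropical.InitialIdeal
import Summits.ResolutionOfSingularities.ResolutionOfSingularities.Theorems.TropicalLinksInductiveStepWeightZero
import Summits.ResolutionOfSingularities.ResolutionOfSingularities.Theorems.TropicalLinksInductiveStepMonomialCriterion

/-!
# TropicalLinks / InductiveStep — brick B0: points of the torus are schön (`SchonAt p 0`)

Route `ResolutionOfSingularities/TropicalLinks`, crux `InductiveStep` (stmt-ResolutionOfSingularities-17233),
line `split`, brick B0: the `d = 0` instance of `SchonAt` (the base of the induction on dimension).

**Statement.** For `k` algebraically closed (of characteristic `p`), every PRIME ideal `I` of the Laurent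
ring `R = k[ℤ^N] = AddMonoidAlgebra k (Fin N → ℤ)` with `dim R ⧸ I = 0` admits `G_1, …, G_m ∉ I`
(here `m = 0`: NO unit is adjoined) such that the re-embedded principal open — extended ideal
`I' = ⟨ι(I), y_j − ι(G_j)⟩ ⊆ S = k[ℤ^(N+m)]` — has every initial degeneration `S ⧸ in_w(I')` regular at
all primes, for every integer weight `w`.

**Proof.** `dim R ⧸ I = 0` and `I` prime make `R ⧸ I` a field (`Ring.KrullDimLE.isField_of_isDomain`);
`R` is a finitely generated `k`-algebra (`ℤ^N` is a finitely generated monoid) and `k` is Jacobson, so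
`R ⧸ I` is finite over `k` (Zariski) and `k → R ⧸ I` is bijective (`k` algebraically closed): `V(I)` is a
`k`-point `χ` of the torus and `x^v − χ(v) ∈ I` for every `v ∈ ℤ^N`. Take `m = 0`. At the weight
`w = 0` the schön clause is (`tropicalLinks_schonClause_weight_zero_iff`) regularity of all
localizations of `(R ⧸ I)[1⁻¹] ≅ R ⧸ I`, a field — fields are regular local rings. At a weight `w ≠ 0`
put `v = −w`; then `x^v − χ(v) ∈ I'` has the two exponents `v` (weight `−|w|² < 0`) and `0` (weight
`0`), so its initial form is the single unit term `x^v`, `in_w(I') = ⊤`, and the clause holds vacuously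
(`tropicalLinks_schonClause_of_card_support_eq_one`).
-/

set_option linter.dupNamespace false -- single-conjunct summit: doubled namespace component is mandated

namespace Summit.ResolutionOfSingularities.ResolutionOfSingularities.Theorems

open AddMonoidAlgebra

/-! ### Fields are regular -/

/-- **Every localization of a field at a prime ideal is a regular local ring** (a field is a
Dedekind domain, hence a regular ring). [folklore] -/
theorem tropicalLinks_forall_prime_regular_of_isField {K : Type} [CommRing K] (hK : IsField K) :
    ∀ (P : Ideal K) [P.IsPrime], IsRegularLocalRing (Localization.AtPrime P) := by
  letI := hK.toField
  intro P _
  infer_instance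

/-- **The principal open of a point at a unit is the point**: for a field `K` and a unit `x ∈ K`,
`K ≃ K[x⁻¹]`, so every localization of `Localization.Away x` at a prime ideal is a regular local
ring. [folklore] -/
theorem tropicalLinks_forall_prime_regular_away_of_isField {K : Type} [CommRing K] (hK : IsField K)
    (x : K) (hx : IsUnit x) :
    ∀ (P : Ideal (Localization.Away x)) [P.IsPrime], IsRegularLocalRing (Localization.AtPrime P) :=
  tropicalLinks_forall_prime_regular_of_ringEquiv
    (IsLocalization.atUnits K (Submonoid.powers x) (S := Localization.Away x) (by
      rintro y ⟨n, rfl⟩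
      exact hx.pow n)).toRingEquiv
    (tropicalLinks_forall_prime_regular_of_isField hK)

/-! ### Zero-dimensional primes of the Laurent ring are `k`-points -/

/-- **A zero-dimensional prime of `k[ℤ^N]` (`k` algebraically closed) is a `k`-rational point of the
torus**: `R ⧸ I` is a field, and every monomial is congruent modulo `I` to a scalar, i.e. for every
exponent `v ∈ ℤ^N` there is `c ∈ k` with `x^v − c ∈ I` (Zariski's lemma / Nullstellensatz).
[folklore] -/
theorem tropicalLinks_isField_and_exists_single_sub_mem (k : Type) [Field k] [IsAlgClosed k] (N : ℕ)
    (I : Ideal (AddMonoidAlgebra k (Fin N → ℤ))) [I.IsPrime]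
    (hdim : ringKrullDim (AddMonoidAlgebra k (Fin N → ℤ) ⧸ I) = ((0 : ℕ) : WithBot ℕ∞)) :
    IsField (AddMonoidAlgebra k (Fin N → ℤ) ⧸ I) ∧
      ∀ v : Fin N → ℤ, ∃ c : k, single v (1 : k) - single 0 c ∈ I := by
  haveI : IsDomain (AddMonoidAlgebra k (Fin N → ℤ) ⧸ I) := Ideal.Quotient.isDomain I
  haveI : Ring.KrullDimLE 0 (AddMonoidAlgebra k (Fin N → ℤ) ⧸ I) :=
    Ring.krullDimLE_iff.mpr (le_of_eq hdim)
  have hfield : IsField (AddMonoidAlgebra k (Fin N → ℤ) ⧸ I) := Ring.KrullDimLE.isField_of_isDomain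
  refine ⟨hfield, fun v => ?_⟩
  letI := hfield.toField
  haveI : AddMonoid.FG (Fin N → ℤ) :=
    AddGroup.fg_iff_addMonoid_fg.1 (Module.Finite.iff_addGroup_fg.1 inferInstance)
  haveI : Module.Finite k (AddMonoidAlgebra k (Fin N → ℤ) ⧸ I) :=
    finite_of_finite_type_of_isJacobsonRing k (AddMonoidAlgebra k (Fin N → ℤ) ⧸ I)
  haveI : Algebra.IsIntegral k (AddMonoidAlgebra k (Fin N → ℤ) ⧸ I) := Algebra.IsIntegral.of_finite k _
  obtain ⟨c, hc⟩ := (IsAlgClosed.algebraMap_bijective_of_isIntegral (k := k)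
    (K := AddMonoidAlgebra k (Fin N → ℤ) ⧸ I)).2 (Ideal.Quotient.mk I (single v 1))
  refine ⟨c, ?_⟩
  rw [← Ideal.Quotient.eq_zero_iff_mem, map_sub, ← hc, sub_eq_zero]
  rfl

/-! ### One-term initial forms -/

/-- **The initial form of `x^a − c` at a weight with `⟨w, a⟩ < 0` is the single term `x^a`**: for
`F ∈ k[ℤ^M]` with coefficient function `δ_a − c·δ_0` and `Σ wᵢ aᵢ < 0`, the route's inlined initial
form `ofCoeff (F.coeff.filter (w-minimal exponents))` (any decidability instance `dec`) has exactly one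
exponent in its support. [folklore] -/
theorem tropicalLinks_card_support_inForm_single_sub {k : Type} [Field k] {M : ℕ} (w : Fin M → ℤ)
    (F : AddMonoidAlgebra k (Fin M → ℤ)) (a : Fin M → ℤ) (c : k)
    (hF : F.coeff = Finsupp.single a 1 - Finsupp.single 0 c) (ha : ∑ i, w i * a i < 0)
    {dec : DecidablePred fun v : Fin M → ℤ => ∀ u ∈ F.coeff.support, ∑ i, w i * v i ≤ ∑ i, w i * u i} :
    (AddMonoidAlgebra.ofCoeff (@Finsupp.filter (Fin M → ℤ) k _
      (fun v : Fin M → ℤ => ∀ u ∈ F.coeff.support, ∑ i, w i * v i ≤ ∑ i, w i * u i) dec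
        F.coeff)).coeff.support.card = 1 := by
  have hwt0 : ∑ i, w i * (0 : Fin M → ℤ) i = 0 := by simp
  have ha0 : a ≠ 0 := by
    rintro rfl
    rw [hwt0] at ha
    exact lt_irrefl _ ha
  have hFa : F.coeff a = 1 := by
    rw [hF, Finsupp.sub_apply, Finsupp.single_eq_same, Finsupp.single_eq_of_ne ha0, sub_zero]
  have ha_mem : a ∈ F.coeff.support := by
    rw [Finsupp.mem_support_iff, hFa]
    exact one_ne_zero
  have hsupp : ∀ u ∈ F.coeff.support, u = a ∨ u = 0 := by
    intro u hu
    by_contra h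
    push Not at h
    apply Finsupp.mem_support_iff.1 hu
    rw [hF, Finsupp.sub_apply, Finsupp.single_eq_of_ne h.1, Finsupp.single_eq_of_ne h.2, sub_zero]
  rw [coeff_ofCoeff, Finsupp.support_filter, Finset.card_eq_one]
  refine ⟨a, Finset.ext fun u => ?_⟩
  rw [Finset.mem_filter, Finset.mem_singleton]
  constructor
  · rintro ⟨hu, hpu⟩
    rcases hsupp u hu with rfl | rfl
    · rfl
    · exfalso
      have h := hpu a ha_mem
      rw [hwt0] at h
      exact (not_le.2 ha) h
  · rintro rfl
    refine ⟨ha_mem, fun u' hu' => ?_⟩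
    rcases hsupp u' hu' with rfl | rfl
    · exact le_rfl
    · rw [hwt0]
      exact ha.le

/-! ### Brick B0: `SchonAt p 0` -/

open scoped Classical in
/-- **Brick B0 — points are schön (`SchonAt p 0`).** For `k` algebraically closed of characteristic
`p` and a prime ideal `I` of `k[ℤ^N]` with `dim k[ℤ^N] ⧸ I = 0`, the route's schön conclusion holds
with `m = 0` (no unit adjoined): at `w = 0` the degeneration is the point itself (a field), at
`w ≠ 0` the initial ideal contains the unit initial form `x^(−w)` of `x^(−w) − χ(−w) ∈ I` and the
degeneration is empty. [folklore] -/
theorem tropicalLinks_schonAt_zero :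
    ∀ p : ℕ, p.Prime → ∀ (k : Type) [Field k] [CharP k p] [IsAlgClosed k] (N : ℕ) (I : Ideal (AddMonoidAlgebra k (Fin N → ℤ))), I.IsPrime → ringKrullDim (AddMonoidAlgebra k (Fin N → ℤ) ⧸ I) = ((0 : ℕ) : WithBot ℕ∞) → ∃ (m : ℕ) (G : Fin m → AddMonoidAlgebra k (Fin N → ℤ)), (∀ j, G j ∉ I) ∧ ∀ (w : Fin (N + m) → ℤ) (P : Ideal (AddMonoidAlgebra k (Fin (N + m) → ℤ) ⧸ Ideal.span ((fun f : AddMonoidAlgebra k (Fin (N + m) → ℤ) => AddMonoidAlgebra.ofCoeff (f.coeff.filter fun v => ∀ u ∈ f.coeff.support, ∑ i, w i * v i ≤ ∑ i, w i * u i)) '' (↑(Ideal.span ((fun f : AddMonoidAlgebra k (Fin N → ℤ) => (AddMonoidAlgebra.ofCoeff (f.coeff.mapDomain fun v => Fin.append v (0 : Fin m → ℤ)) : AddMonoidAlgebra k (Fin (N + m) → ℤ))) '' (↑I : Set (AddMonoidAlgebra k (Fin N → ℤ))) ∪ Set.range (fun j : Fin m => AddMonoidAlgebra.single (Fin.append (0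 : Fin N → ℤ) (Pi.single j (1 : ℤ))) (1 : k) - AddMonoidAlgebra.ofCoeff ((G j).coeff.mapDomain fun v => Fin.append v (0 : Fin m → ℤ))))) : Set (AddMonoidAlgebra k (Fin (N + m) → ℤ)))))) [P.IsPrime], IsRegularLocalRing (Localization.AtPrime P) := by
  intro p _ k _ _ _ N I hI hdim
  obtain ⟨hfield, hpt⟩ := tropicalLinks_isField_and_exists_single_sub_mem k N I hdim
  refine ⟨0, fun j => Fin.elim0 j, fun j => Fin.elim0 j, ?_⟩
  intro w P hP
  by_cases hw : w = 0
  · -- the weight `w = 0`: the degeneration is the point `(R ⧸ I)[1⁻¹]`, a field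
    have hx : IsUnit (Ideal.Quotient.mk I
        (∏ j : Fin 0, (fun j : Fin 0 => (Fin.elim0 j : AddMonoidAlgebra k (Fin N → ℤ))) j)) := by
      rw [Finset.univ_eq_empty, Finset.prod_empty, map_one]
      exact isUnit_one
    exact (tropicalLinks_schonClause_weight_zero_iff k N 0 I (fun j => Fin.elim0 j) _ rfl w hw).1
      (tropicalLinks_forall_prime_regular_away_of_isField hfield _ hx) P
  · -- a weight `w ≠ 0`: `x^(−w) − χ(−w) ∈ I'` has the unit initial form `x^(−w)`
    obtain ⟨l, hl⟩ := Function.ne_iff.1 hw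
    obtain ⟨c, hc⟩ := hpt fun i => -(w (Fin.castAdd 0 i))
    have hg0 : (Fin.append (0 : Fin N → ℤ) (0 : Fin 0 → ℤ) : Fin (N + 0) → ℤ) = 0 := by
      funext i
      exact Fin.addCases (fun i => by rw [Fin.append_left, Pi.zero_apply, Pi.zero_apply])
        (fun j => j.elim0) i
    have hF : (AddMonoidAlgebra.ofCoeff ((single (fun i => -(w (Fin.castAdd 0 i))) (1 : k) -
        single (0 : Fin N → ℤ) c).coeff.mapDomain fun v => Fin.append v (0 : Fin 0 → ℤ)) :
          AddMonoidAlgebra k (Fin (N + 0) → ℤ)).coeff =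
        Finsupp.single (Fin.append (fun i => -(w (Fin.castAdd 0 i))) (0 : Fin 0 → ℤ)) 1 -
          Finsupp.single 0 c := by
      rw [coeff_ofCoeff, coeff_sub, coeff_single, coeff_single, Finsupp.mapDomain_sub,
        Finsupp.mapDomain_single, Finsupp.mapDomain_single, hg0]
    have ha : ∑ i, w i * Fin.append (fun i => -(w (Fin.castAdd 0 i))) (0 : Fin 0 → ℤ) i < 0 := by
      rw [Fin.sum_univ_add]
      simp only [Fin.append_left, Fin.append_right, Finset.univ_eq_empty, Finset.sum_empty,
        add_zero, mul_neg, Finset.sum_neg_distrib, Left.neg_neg_iff]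
      refine Finset.sum_pos' (fun i _ => mul_self_nonneg _)
        ⟨Fin.cast (Nat.add_zero N) l, Finset.mem_univ _, ?_⟩
      have hl' : Fin.castAdd 0 (Fin.cast (Nat.add_zero N) l) = l := Fin.ext rfl
      rw [hl']
      exact mul_self_pos.2 hl
    exact tropicalLinks_schonClause_of_card_support_eq_one k N 0 I (fun j => Fin.elim0 j) _ _
      (Ideal.subset_span (Or.inl ⟨_, hc, rfl⟩))
      (tropicalLinks_card_support_inForm_single_sub w _ _ c hF ha) P

end Summit.ResolutionOfSingularities.ResolutionOfSingularities.Theorems
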